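import Literature.NumberTheory.EllipticCurves.InertiaFixedTorsionAdditiveVanishingProofs
import Literature.NumberTheory.EllipticCurves.LocalTorsionAwayFromResidueCharProofs
import Literature.NumberTheory.EllipticCurves.HondaStrongIsomorphismMultiplicativeProofs
import Literature.NumberTheory.EllipticCurves.QuadraticTwistLocalPolynomialProofs
import Literature.NumberTheory.EllipticCurves.StrictSelmerRankOne
import Literature.NumberTheory.EllipticCurves.LFunctionPrimeCoeff
import Mathlib.NumberTheory.Padics.HeightOneSpectrum
import Mathlib.NumberTheory.LegendreSymbol.JacobiSymbol
import HarnessLib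

/-!
# `E(K_v)[p] = 0` at a NON-SPLIT multiplicative place `v ∤ p` with `p ∤ q_v + 1` (`p` odd), Galois
# descent to the decomposition-fixed `p`-power torsion, and the local clause (c3) of the fine-Selmer
# roads over `ℚ` from decidable certificates (theorems only)

`Proofs` file (theorems only: no definition, no named fact, no instance, no `sorry`), topic
`NumberTheory/EllipticCurves`; the MULTIPLICATIVE companion of the tree's
`InertiaFixedTorsionAdditiveVanishingProofs` (additive `v ∤ p`, `p ≥ 5`: `E(K_v^nr)[p^∞] = 0`), for the
clause **(c3)** "`E(F_v)[p] = 0` for every `v ∈ S`" of Deo–Ray–Sujatha (Thm. 3.9) in the shape of the binder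
`hloc : ∀ v, (p ∈ v ∨ ¬ good at v) → ∀ x : E[p^∞], p x = 0 → (∀ d ∈ D_v, d x = x) → x = 0`
of the tree's fine-Selmer roads (`CoatesSujatha2005.SelmerTrivialRoad.conjA_of_selmerGroup_eq_bot`,
`DeoRaySujatha2023.thm39_…`).

* §1 **Galois descent** `geomPrimaryTorsion_eq_zero_of_decomp_fixed_of_localPoints`: for `E/K` over a number
  field and a finite place `v`, if `E(K_v)` has no point of order `p` then every `x ∈ E(K̄)[p^∞]` with `p x = 0`
  fixed by the decomposition group `D_v = GreenbergSelmer.decomp v` (of the tree's chosen embedding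
  `K̄ → K̄_v`) is `0`: its image in `E(K̄_v)` is `Γ_{K_v}`-fixed, hence comes from `E(K_v)` (Silverman I.§1,
  "`V(K) = {P ∈ V : P^σ = P}`", tree `exists_map_eq_of_forall_smul_localPoints_eq`).  This is a
  Literature-side port — same proof, line by line — of the cell `b2b-bsdres`'s Summits-side
  `X11b.AcSelmer.eq_zero_of_fixed_decomp_of_local` (`Summits/…/X11b/AnticyclotomicLocalTorsionDescent.lean`),
  which cannot be imported under `Literature/`.
* §2 **`E(K_v)[p] = 0` at a non-split multiplicative `v ∤ p`, `p` odd, `p ∤ q_v + 1`**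
  (`forall_point_eq_zero_of_nonsplit`): the tree's `natCard_primePowTorsion_dvd_of_nonsplit`
  (`#E(K_v)[p] ∣ q_v + 1`: `E₁(K_v)` has no prime-to-`v` torsion, Silverman VII.3.1; `E₀/E₁ ≅ Ẽ_ns(k_v)` of
  order `q_v + 1` at a non-split node, VII.2.1 and Ex. 3.5; `[E(K_v) : E₀(K_v)] ∈ {1, 2}` for non-split
  multiplicative reduction, C.15.2.1 / Kodaira–Néron VII.6.1) and "a non-zero point killed by `p` has
  order `p ∣ #E(K_v)[p]`"; with §1 the clause (c3) at such a `v`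
  (`geomPrimaryTorsion_eq_zero_of_decomp_fixed_of_nonsplit`).
* §3 the (c3) binder when every bad `v ∤ p` is **additive OR carries the clause**
  (`geomPrimaryTorsion_decomp_fixed_eq_zero_of_additive_or_clause_away`; additive places by
  `geomPrimaryTorsion_eq_zero_of_decomp_fixed_of_hasAdditiveReductionAt`, `p ≥ 5`).
* §4 over `ℚ`, `W` globally minimal, everything from DECIDABLE integer certificates on
  `E₀ = integralModelInt W`: at an odd prime `ℓ ∣ Δ_min`, `ℓ ∤ c₄` (multiplicative, Silverman VII.5.1 (b),
  tree `hasMultiplicativeReductionAt_of_dvd_of_not_dvd`) the reduction is **split iff `−c₄c₆` is a square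
  mod `ℓ`** (`hasSplitMultiplicativeReductionAt_iff_isSquare`: the tree's criterion
  `hasSplitMultiplicativeReductionAt_iff_splits` — the node-tangent quadratic
  `c₄T² + a₁c₄T − (54b₆ − 3b₂b₄ + a₂c₄)` of `E₀ mod ℓ` splits — plus `splits_quadratic_iff_isSquare_discrim`
  and `discrim_nodalTangents` (its discriminant is `−c₄c₆`)); hence NON-SPLIT certificates
  `not_hasSplitMultiplicativeReductionAt_of_not_isSquare` / `…_of_jacobiSym_eq_neg_one` (odd `ℓ`) and
  `…_of_forall_ne_zero` (any `ℓ`, the quadratic has no root mod `ℓ`); the clause at the place over `ℓ`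
  (`geomPrimaryTorsion_eq_zero_of_decomp_fixed_of_nonsplit_rat`, `q_v = ℓ`); the clause at the place over
  `p` from "`E(ℚ_p)[p] = 0`" stated on Mathlib's `ℚ_[p]` (`geomPrimaryTorsion_eq_zero_of_decomp_fixed_of_padic`,
  transport along `Padic.adicCompletionEquiv`); and the whole binder `hloc` from ONE divisibility
  `Δ_min ∣ p^a · c₄^b · m` (a bad `ℓ' ≠ p` divides `c₄` — additive — or `m`) plus the clauses at the prime
  factors of `m` and at `p` (`geomPrimaryTorsion_decomp_fixed_eq_zero_of_dvd_pow_mul_pow_mul`, and its forms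
  with `m = 1`, `m = ℓ^c`, `m = ℓ₁^{c₁} ℓ₂^{c₂}` and the non-split clauses supplied:
  `…_of_dvd_pow_mul_pow_of_padic`, `…_of_nonsplit_of_padic`, `…_of_nonsplit₂_of_padic`).

Consumer: the per-row records of the cell `bsd-potss` (items stmt-BirchSwinnertonDyer-19413 / 19386, record
lanes `k8t-c4` / `k9-c4`): the 27 rows of the KT table at `p = 5` whose (c3) clause passes at a
multiplicative place (all NON-SPLIT with `5 ∤ ℓ + 1`; census `KT-MULT-PLACES-c3-conjA-anchor-g25.tsv`), and the
79 all-additive rows (now without the Summits-side descent).  What is NOT here: split multiplicative `v`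
(there `E(K_v)[p] ≠ 0` as soon as `p ∣ v(Δ)` and `μ_p ⊄ K_v` fails — Tate curve; the roads are void on the
cell's 54 such rows), the clause at `v ∣ p` itself (tree `LocalTorsionAdditiveFiveNonExceptionalProofs`),
`p = 2`.  Nothing is asserted about any curve; BSD / statement (A) is proved for no class of curves here.

## References

* [SilvermanAEC2009] J. H. Silverman, *The Arithmetic of Elliptic Curves*, 2nd ed. (2009): I.§1 (held text
  `p0016`: "`V(K) = {P ∈ V : P^σ = P for all σ ∈ G_{K̄/K}}`"), Prop. VII.2.1 (`p0167`), Prop. VII.3.1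
  (`p0170`), VII.5 Definition and Prop. 5.1 (b) (`p0174`: "the reduction is said to be *split* if the slopes
  of the tangent lines at the node are in k"), Thm. VII.6.1 (`p0177`), Cor. C.15.2.1 (`p0387`: "if E has
  nonsplit multiplicative reduction, then … `E(K)/E₀(K)` has order 1 or 2"), Exercise 3.5 (`p0097`).
* [DeoRaySujatha2023] S. V. Deo, A. Ray, R. Sujatha, *On the `μ` equals zero conjecture for fine Selmer
  groups in Iwasawa theory*, Pure Appl. Math. Q. 19 (2023), Thm. 3.9, condition "for every prime `v ∈ S`,
  `E(F_v)[p] = 0`" (arXiv:2202.09937 p. 10).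
* [NeukirchANT1999] J. Neukirch, *Algebraic Number Theory* (1999), Ch. I §8, Ch. II §9 Prop. (9.6).

Design: no definitions; one universe `u` for the number-field sections, `ℚ : Type` in §4; dot-notation
theorems in `namespace WeierstrassCurve` (deliberate extension, as the sibling `…Proofs` files).
-/

noncomputable section

open scoped Classical
open NumberField IsDedekindDomain Field Polynomial

universe u

namespace WeierstrassCurve

open Literature.NumberTheory.EllipticCurves Literature.NumberTheory.GaloisRepresentations
  Literature.NumberTheory.EllipticCurves.GreenbergSelmer IsDedekindDomain.HeightOneSpectrum

/-! ## §1 Galois descent: `E(K_v)[p] = 0 ⟹ E(K̄)[p^∞]^{D_v}[p] = 0` -/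

section NumberField

variable {K : Type u} [Field K] [NumberField K] (W : WeierstrassCurve K)

/-- **Galois descent at `v`.**  If `E(K_v)` has no non-zero point killed by `p`, then a point
`x ∈ E(K̄)[p^∞]` with `p x = 0` fixed by the decomposition group `D_v = GreenbergSelmer.decomp v` is `0`:
its image `ι₀(x) ∈ E(K̄_v)` along the chosen embedding `ι₀ : K̄ → K̄_v` is fixed by `Γ_{K_v}` (`D_v` is the
image of `Γ_{K_v}`, `pointsMapOfEmb_smul`), hence comes from a point `R ∈ E(K_v)`
(`exists_map_eq_of_forall_smul_localPoints_eq`), and `p R = 0` by injectivity of `E(K_v) → E(K̄_v)`; so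
`R = 0`, `ι₀(x) = 0`, `x = 0`.  (Port of the Summits-side `X11b.AcSelmer.eq_zero_of_fixed_decomp_of_local`.)
[cite: SilvermanAEC2009, I.§1 (held text p0016, "V(K) = {P ∈ V : P^σ = P}") and VIII.§1]
[cite: NeukirchANT1999, Ch. II §9 Prop. (9.6)] -/
theorem geomPrimaryTorsion_eq_zero_of_decomp_fixed_of_localPoints (p : ℕ) (v : HeightOneSpectrum (𝓞 K))
    (hKv : ∀ R : (W.baseChange (v.adicCompletion K)).toAffine.Point, p • R = 0 → R = 0)
    (x : W.geomPrimaryTorsion p) (hpx : p • x = 0)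
    (hfix : ∀ d ∈ GreenbergSelmer.decomp v, d • x = x) : x = 0 := by
  set ι₀ := closureEmb (K := K) (v.adicCompletion K) with hι₀
  set X : localPoints W (v.adicCompletion K) := pointsMapOfEmb W ι₀ (x : W.geomPoints) with hX
  -- `X` is fixed by `Γ_{K_v}`
  have hXfix : ∀ τ : absoluteGaloisGroup (v.adicCompletion K), τ • X = X := fun τ ↦ by
    have hmem : resGalOfEmb ι₀ τ ∈ GreenbergSelmer.decomp v := (mem_decomp_iff v _).mpr ⟨τ, rfl⟩
    have h : resGalOfEmb ι₀ τ • (x : W.geomPoints) = x :=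
      congrArg (fun y : W.geomPrimaryTorsion p ↦ (y : W.geomPoints)) (hfix _ hmem)
    rw [hX, ← pointsMapOfEmb_smul, h]
  -- descent to `E(K_v)` (`K_v` has characteristic `0`, hence is perfect)
  haveI : CharZero (v.adicCompletion K) :=
    charZero_of_injective_algebraMap (algebraMap K (v.adicCompletion K)).injective
  obtain ⟨R, hR⟩ := exists_map_eq_of_forall_smul_localPoints_eq W (v.adicCompletion K) hXfix
  have hinj := Affine.Point.map_injective (W' := W)
    (IsScalarTower.toAlgHom K (v.adicCompletion K) (AlgebraicClosure (v.adicCompletion K)))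
  have hpX : p • X = 0 := by
    have h1 : pointsMapOfEmb W ι₀ ((p • x : W.geomPrimaryTorsion p) : W.geomPoints) = p • X := by
      rw [AddSubgroupClass.coe_nsmul, (pointsMapOfEmb W ι₀).map_nsmul]
    rw [← h1, hpx, ZeroMemClass.coe_zero, (pointsMapOfEmb W ι₀).map_zero]
  have hpR : p • R = 0 := by
    apply hinj
    rw [map_nsmul, hR, map_zero]
    exact hpX
  have hR0 : R = 0 := hKv R hpR
  have hX0 : X = 0 := by rw [← hR, hR0]; exact map_zero _
  have hx0 : (x : W.geomPoints) = 0 :=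
    pointsMapOfEmb_injective W ι₀ (by rw [(pointsMapOfEmb W ι₀).map_zero, ← hX]; exact hX0)
  exact Subtype.ext (by rw [hx0]; rfl)

/-! ## §2 `E(K_v)[p] = 0` at a non-split multiplicative `v ∤ p`, `p` odd, `p ∤ q_v + 1` -/

/-- **`E(K_v)[p] = 0` at a NON-SPLIT multiplicative place `v ∤ p`** for an odd prime `p` with
`p ∤ q_v + 1` (`q_v = #k_v`): the tree's `natCard_primePowTorsion_dvd_of_nonsplit` gives
`#E(K_v)[p] ∣ q_v + 1` (`E₁` has no prime-to-`v` torsion, VII.3.1; `E₀/E₁ ≅ Ẽ_ns(k_v)` has `q_v + 1` points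
at a non-split node, VII.2.1 / Ex. 3.5; `[E : E₀] ∈ {1, 2}`, C.15.2.1), and a non-zero point killed by `p`
would have order `p ∣ #E(K_v)[p]`.
[cite: SilvermanAEC2009, Prop. VII.2.1 (p0167), Prop. VII.3.1 (p0170), Cor. C.15.2.1 (p0387), Exercise 3.5 (p0097)] -/
theorem forall_point_eq_zero_of_nonsplit [W.IsElliptic] {v : HeightOneSpectrum (𝓞 K)}
    (hmult : W.HasMultiplicativeReductionAt v) (hns : ¬ W.HasSplitMultiplicativeReductionAt v)
    {p : ℕ} (hp : p.Prime) (hp2 : p ≠ 2) (hpv : (p : 𝓞 K) ∉ v.asIdeal)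
    (hq : ¬ p ∣ Nat.card (IsLocalRing.ResidueField (v.adicCompletionIntegers K)) + 1) :
    ∀ R : (W.baseChange (v.adicCompletion K)).toAffine.Point, p • R = 0 → R = 0 := by
  intro R hR
  by_contra hR0
  haveI : Fact p.Prime := ⟨hp⟩
  have hdvd := W.natCard_primePowTorsion_dvd_of_nonsplit v hmult hns hp hp2 hpv 1
  rw [pow_one] at hdvd
  have hRT : R ∈ (nsmulAddMonoidHom p : (W.baseChange (v.adicCompletion K)).toAffine.Point →+ _).ker := by
    rw [AddMonoidHom.mem_ker, nsmulAddMonoidHom_apply]; exact hR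
  have hord : addOrderOf (⟨R, hRT⟩ :
      (nsmulAddMonoidHom p : (W.baseChange (v.adicCompletion K)).toAffine.Point →+ _).ker) = p := by
    rw [← AddSubgroup.addOrderOf_coe]
    exact addOrderOf_eq_prime hR hR0
  exact hq ((hord ▸ addOrderOf_dvd_natCard _).trans hdvd)

/-- **The clause (c3) at a non-split multiplicative `v ∤ p`** (`p` odd, `p ∤ q_v + 1`), VERBATIM in the shape
of the tree's binder `hloc`: every `x ∈ E[p^∞]` with `p x = 0` fixed by `D_v` is `0` (§2 + Galois descent §1).
[cite: DeoRaySujatha2023, Thm. 3.9, condition "E(F_v)[p] = 0 for every v ∈ S" (arXiv:2202.09937 p. 10)]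
[cite: SilvermanAEC2009, Cor. C.15.2.1 (p0387) and Exercise 3.5 (p0097)] -/
theorem geomPrimaryTorsion_eq_zero_of_decomp_fixed_of_nonsplit [W.IsElliptic] {v : HeightOneSpectrum (𝓞 K)}
    (hmult : W.HasMultiplicativeReductionAt v) (hns : ¬ W.HasSplitMultiplicativeReductionAt v)
    {p : ℕ} (hp : p.Prime) (hp2 : p ≠ 2) (hpv : (p : 𝓞 K) ∉ v.asIdeal)
    (hq : ¬ p ∣ Nat.card (IsLocalRing.ResidueField (v.adicCompletionIntegers K)) + 1)
    (x : W.geomPrimaryTorsion p) (hpx : p • x = 0) (hfix : ∀ d ∈ GreenbergSelmer.decomp v, d • x = x) :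
    x = 0 :=
  W.geomPrimaryTorsion_eq_zero_of_decomp_fixed_of_localPoints p v
    (W.forall_point_eq_zero_of_nonsplit hmult hns hp hp2 hpv hq) x hpx hfix

/-! ## §3 The (c3) binder when every bad `v ∤ p` is additive or carries the clause -/

/-- **(c3) from: every bad place `v ∤ p` is additive OR satisfies the clause, plus the clauses above `p`**
(`p ≥ 5`; additive places by `E(K_v^nr)[p^∞] = 0`, tree
`geomPrimaryTorsion_eq_zero_of_decomp_fixed_of_hasAdditiveReductionAt`).
[cite: DeoRaySujatha2023, Thm. 3.9, condition "E(F_v)[p] = 0 for every v ∈ S" (arXiv:2202.09937 p. 10)]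
[cite: SilvermanAEC2009, Thm. VII.6.1 (p0177)] -/
theorem geomPrimaryTorsion_decomp_fixed_eq_zero_of_additive_or_clause_away [W.IsElliptic] {p : ℕ}
    (hp : p.Prime) (hp5 : 5 ≤ p)
    (hbad : ∀ v : HeightOneSpectrum (𝓞 K), ¬ W.HasGoodReductionAt v → (p : 𝓞 K) ∉ v.asIdeal →
      W.HasAdditiveReductionAt v ∨
        ∀ x : W.geomPrimaryTorsion p, p • x = 0 → (∀ d ∈ GreenbergSelmer.decomp v, d • x = x) → x = 0)
    (hlocp : ∀ v : HeightOneSpectrum (𝓞 K), (p : 𝓞 K) ∈ v.asIdeal →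
      ∀ x : W.geomPrimaryTorsion p, p • x = 0 → (∀ d ∈ GreenbergSelmer.decomp v, d • x = x) → x = 0) :
    ∀ v : HeightOneSpectrum (𝓞 K), ((p : 𝓞 K) ∈ v.asIdeal ∨ ¬ W.HasGoodReductionAt v) →
      ∀ x : W.geomPrimaryTorsion p, p • x = 0 → (∀ d ∈ GreenbergSelmer.decomp v, d • x = x) → x = 0 := by
  intro v hv x hpx hfix
  by_cases hpv : (p : 𝓞 K) ∈ v.asIdeal
  · exact hlocp v hpv x hpx hfix
  · rcases hbad v (hv.resolve_left hpv) hpv with hadd | hcl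
    · exact W.geomPrimaryTorsion_eq_zero_of_decomp_fixed_of_hasAdditiveReductionAt hadd hp hp5 hpv x hpx hfix
    · exact hcl x hpx hfix

end NumberField

/-! ## §4 Over `ℚ`: split ⟺ `−c₄c₆` is a square mod `ℓ`; the clauses and the binder from certificates -/

section Rat

open Rat.HeightOneSpectrum

variable (W : WeierstrassCurve ℚ) [W.IsElliptic] [W.IsGloballyMinimal]

/-- **Split ⟺ `−c₄ c₆` is a square mod `ℓ`** (`ℓ` odd).  At a prime `ℓ ∣ Δ_min`, `ℓ ∤ c₄` (multiplicative
reduction) of a globally minimal `W/ℚ`, at the place `v` over `ℓ`: the reduction is split iff `−c₄(E₀)c₆(E₀)`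
is a square in `ℤ/ℓ`, `E₀ = integralModelInt W` — the node-tangent quadratic
`c₄T² + a₁c₄T − (54b₆ − 3b₂b₄ + a₂c₄)` of `E₀ mod ℓ` (tree `hasSplitMultiplicativeReductionAt_iff_splits`) has
discriminant `−c₄c₆` (`discrim_nodalTangents`) and a quadratic over a field of odd characteristic splits iff
its discriminant is a square (`splits_quadratic_iff_isSquare_discrim`).
[cite: SilvermanAEC2009, VII.5 Definition and Prop. 5.1 (b) (p0174) and VII.1 Prop. 1.3 (b)] -/
theorem hasSplitMultiplicativeReductionAt_iff_isSquare (v : HeightOneSpectrum (𝓞 ℚ))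
    (hΔ : ((primesEquiv v : ℕ) : ℤ) ∣ minimalDiscriminantInt W)
    (hc₄ : ¬ ((primesEquiv v : ℕ) : ℤ) ∣ (integralModelInt W).c₄) (h2 : (primesEquiv v : ℕ) ≠ 2) :
    W.HasSplitMultiplicativeReductionAt v ↔
      IsSquare ((-((integralModelInt W).c₄ * (integralModelInt W).c₆) : ℤ) : ZMod (primesEquiv v : ℕ)) := by
  haveI : Fact (primesEquiv v : ℕ).Prime := ⟨(primesEquiv v).2⟩
  haveI : NeZero (2 : ZMod (primesEquiv v : ℕ)) := ⟨by
    intro h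
    have h' : ((2 : ℕ) : ZMod (primesEquiv v : ℕ)) = 0 := by exact_mod_cast h
    rw [ZMod.natCast_eq_zero_iff] at h'
    exact h2 ((Nat.prime_dvd_prime_iff_eq (primesEquiv v).2 Nat.prime_two).mp h')⟩
  rw [W.hasSplitMultiplicativeReductionAt_iff_splits v hΔ hc₄]
  set I := (integralModelInt W).map (Int.castRingHom (ZMod (primesEquiv v : ℕ))) with hI
  have hIc₄ : I.c₄ ≠ 0 := by
    rw [hI, map_c₄, eq_intCast, Ne, ZMod.intCast_zmod_eq_zero_iff_dvd]; exact hc₄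
  have hI₄ : I.c₄ = ((integralModelInt W).c₄ : ZMod (primesEquiv v : ℕ)) := by rw [hI, map_c₄, eq_intCast]
  have hI₆ : I.c₆ = ((integralModelInt W).c₆ : ZMod (primesEquiv v : ℕ)) := by rw [hI, map_c₆, eq_intCast]
  rw [sub_eq_add_neg, ← C_neg, splits_quadratic_iff_isSquare_discrim hIc₄, discrim_nodalTangents, hI₄, hI₆]
  push_cast
  exact Iff.rfl

/-- **Non-split certificate (odd `ℓ`): `−c₄c₆` is not a square mod `ℓ`.**
[cite: SilvermanAEC2009, VII.5 Definition and Prop. 5.1 (b) (p0174)] -/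
theorem not_hasSplitMultiplicativeReductionAt_of_not_isSquare (v : HeightOneSpectrum (𝓞 ℚ))
    (hΔ : ((primesEquiv v : ℕ) : ℤ) ∣ minimalDiscriminantInt W)
    (hc₄ : ¬ ((primesEquiv v : ℕ) : ℤ) ∣ (integralModelInt W).c₄) (h2 : (primesEquiv v : ℕ) ≠ 2)
    (hns : ¬ IsSquare ((-((integralModelInt W).c₄ * (integralModelInt W).c₆) : ℤ) : ZMod (primesEquiv v : ℕ))) :
    ¬ W.HasSplitMultiplicativeReductionAt v :=
  fun h ↦ hns ((W.hasSplitMultiplicativeReductionAt_iff_isSquare v hΔ hc₄ h2).mp h)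

/-- **Non-split certificate (odd `ℓ`), Jacobi-symbol form: `(−c₄c₆ | ℓ) = −1`** (Mathlib
`ZMod.nonsquare_of_jacobiSym_eq_neg_one`; `norm_num` evaluates Jacobi symbols).
[cite: SilvermanAEC2009, VII.5 Definition and Prop. 5.1 (b) (p0174)] -/
theorem not_hasSplitMultiplicativeReductionAt_of_jacobiSym_eq_neg_one (v : HeightOneSpectrum (𝓞 ℚ))
    (hΔ : ((primesEquiv v : ℕ) : ℤ) ∣ minimalDiscriminantInt W)
    (hc₄ : ¬ ((primesEquiv v : ℕ) : ℤ) ∣ (integralModelInt W).c₄) (h2 : (primesEquiv v : ℕ) ≠ 2)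
    (hj : jacobiSym (-((integralModelInt W).c₄ * (integralModelInt W).c₆)) (primesEquiv v : ℕ) = -1) :
    ¬ W.HasSplitMultiplicativeReductionAt v :=
  W.not_hasSplitMultiplicativeReductionAt_of_not_isSquare v hΔ hc₄ h2 (ZMod.nonsquare_of_jacobiSym_eq_neg_one hj)

/-- **Non-split certificate (any `ℓ`, also `ℓ = 2`): the node-tangent quadratic of `E₀ mod ℓ` has no root
in `ℤ/ℓ`** (a splitting quadratic over a field has a root). [cite: SilvermanAEC2009, VII.5 Definition and Prop. 5.1 (b) (p0174)] -/
theorem not_hasSplitMultiplicativeReductionAt_of_forall_ne_zero (v : HeightOneSpectrum (𝓞 ℚ))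
    (hΔ : ((primesEquiv v : ℕ) : ℤ) ∣ minimalDiscriminantInt W)
    (hc₄ : ¬ ((primesEquiv v : ℕ) : ℤ) ∣ (integralModelInt W).c₄)
    (h : ∀ r : ZMod (primesEquiv v : ℕ),
      ((integralModelInt W).c₄ : ZMod (primesEquiv v : ℕ)) * r ^ 2 +
          ((integralModelInt W).a₁ : ZMod (primesEquiv v : ℕ)) * (integralModelInt W).c₄ * r -
        (54 * ((integralModelInt W).b₆ : ZMod (primesEquiv v : ℕ)) -
          3 * ((integralModelInt W).b₂ : ZMod (primesEquiv v : ℕ)) * (integralModelInt W).b₄ +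
          ((integralModelInt W).a₂ : ZMod (primesEquiv v : ℕ)) * (integralModelInt W).c₄) ≠ 0) :
    ¬ W.HasSplitMultiplicativeReductionAt v := by
  haveI : Fact (primesEquiv v : ℕ).Prime := ⟨(primesEquiv v).2⟩
  rw [W.hasSplitMultiplicativeReductionAt_iff_splits v hΔ hc₄]
  set I := (integralModelInt W).map (Int.castRingHom (ZMod (primesEquiv v : ℕ))) with hI
  have hIc₄ : I.c₄ ≠ 0 := by
    rw [hI, map_c₄, eq_intCast, Ne, ZMod.intCast_zmod_eq_zero_iff_dvd]; exact hc₄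
  intro hs
  have hdeg : (C I.c₄ * X ^ 2 + C (I.a₁ * I.c₄) * X - C (54 * I.b₆ - 3 * I.b₂ * I.b₄ + I.a₂ * I.c₄)).degree ≠ 0 := by
    rw [sub_eq_add_neg, ← C_neg, degree_quadratic hIc₄]; decide
  obtain ⟨r, hr⟩ := hs.exists_eval_eq_zero hdeg
  apply h r
  simp only [eval_sub, eval_add, eval_mul, eval_C, eval_pow, eval_X] at hr
  rw [hI, map_c₄, map_a₁, map_a₂, map_b₂, map_b₄, map_b₆, eq_intCast, eq_intCast, eq_intCast, eq_intCast,
    eq_intCast, eq_intCast] at hr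
  exact hr

/-- The same three statements at the place over a given prime `ℓ` (the form consumed by records: `ℓ` a
numeral, `v` any place containing `ℓ`): **split ⟺ `−c₄c₆` is a square mod `ℓ`**, `ℓ` odd.
[cite: SilvermanAEC2009, VII.5 Definition and Prop. 5.1 (b) (p0174)] -/
theorem hasSplitMultiplicativeReductionAt_iff_isSquare_of_mem {ℓ : ℕ} (hℓ : ℓ.Prime) (hℓ2 : ℓ ≠ 2)
    (v : HeightOneSpectrum (𝓞 ℚ)) (hv : (ℓ : 𝓞 ℚ) ∈ v.asIdeal)
    (hΔ : (ℓ : ℤ) ∣ minimalDiscriminantInt W) (hc₄ : ¬ (ℓ : ℤ) ∣ (integralModelInt W).c₄) :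
    W.HasSplitMultiplicativeReductionAt v ↔
      IsSquare ((-((integralModelInt W).c₄ * (integralModelInt W).c₆) : ℤ) : ZMod ℓ) := by
  have hv' : primesEquiv v = ⟨ℓ, hℓ⟩ := by
    rw [(natCast_mem_asIdeal_iff_eq_primesEquiv_symm v hℓ).mp hv, Equiv.apply_symm_apply]
  have key : ∀ q : Nat.Primes, primesEquiv v = q → (q : ℕ) ≠ 2 →
      ((q : ℕ) : ℤ) ∣ minimalDiscriminantInt W → ¬ ((q : ℕ) : ℤ) ∣ (integralModelInt W).c₄ →
      (W.HasSplitMultiplicativeReductionAt v ↔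
        IsSquare ((-((integralModelInt W).c₄ * (integralModelInt W).c₆) : ℤ) : ZMod (q : ℕ))) := by
    rintro q rfl h2 hΔ' hc₄'
    exact W.hasSplitMultiplicativeReductionAt_iff_isSquare v hΔ' hc₄' h2
  exact key ⟨ℓ, hℓ⟩ hv' hℓ2 hΔ hc₄

/-- **Non-split at the place over `ℓ` (odd) from `−c₄c₆` not a square mod `ℓ`.**
[cite: SilvermanAEC2009, VII.5 Definition and Prop. 5.1 (b) (p0174)] -/
theorem not_hasSplitMultiplicativeReductionAt_of_not_isSquare_of_mem {ℓ : ℕ} (hℓ : ℓ.Prime) (hℓ2 : ℓ ≠ 2)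
    (v : HeightOneSpectrum (𝓞 ℚ)) (hv : (ℓ : 𝓞 ℚ) ∈ v.asIdeal)
    (hΔ : (ℓ : ℤ) ∣ minimalDiscriminantInt W) (hc₄ : ¬ (ℓ : ℤ) ∣ (integralModelInt W).c₄)
    (hns : ¬ IsSquare ((-((integralModelInt W).c₄ * (integralModelInt W).c₆) : ℤ) : ZMod ℓ)) :
    ¬ W.HasSplitMultiplicativeReductionAt v :=
  fun h ↦ hns ((W.hasSplitMultiplicativeReductionAt_iff_isSquare_of_mem hℓ hℓ2 v hv hΔ hc₄).mp h)

/-- **Non-split at the place over `ℓ` (any prime `ℓ`) from a root-free node-tangent quadratic mod `ℓ`.**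
[cite: SilvermanAEC2009, VII.5 Definition and Prop. 5.1 (b) (p0174)] -/
theorem not_hasSplitMultiplicativeReductionAt_of_forall_ne_zero_of_mem {ℓ : ℕ} (hℓ : ℓ.Prime)
    (v : HeightOneSpectrum (𝓞 ℚ)) (hv : (ℓ : 𝓞 ℚ) ∈ v.asIdeal)
    (hΔ : (ℓ : ℤ) ∣ minimalDiscriminantInt W) (hc₄ : ¬ (ℓ : ℤ) ∣ (integralModelInt W).c₄)
    (h : ∀ r : ZMod ℓ,
      ((integralModelInt W).c₄ : ZMod ℓ) * r ^ 2 + ((integralModelInt W).a₁ : ZMod ℓ) * (integralModelInt W).c₄ * r -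
        (54 * ((integralModelInt W).b₆ : ZMod ℓ) - 3 * ((integralModelInt W).b₂ : ZMod ℓ) * (integralModelInt W).b₄ +
          ((integralModelInt W).a₂ : ZMod ℓ) * (integralModelInt W).c₄) ≠ 0) :
    ¬ W.HasSplitMultiplicativeReductionAt v := by
  have hv' : primesEquiv v = ⟨ℓ, hℓ⟩ := by
    rw [(natCast_mem_asIdeal_iff_eq_primesEquiv_symm v hℓ).mp hv, Equiv.apply_symm_apply]
  have key : ∀ q : Nat.Primes, primesEquiv v = q →
      ((q : ℕ) : ℤ) ∣ minimalDiscriminantInt W → ¬ ((q : ℕ) : ℤ) ∣ (integralModelInt W).c₄ →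
      (∀ r : ZMod (q : ℕ),
        ((integralModelInt W).c₄ : ZMod (q : ℕ)) * r ^ 2 +
            ((integralModelInt W).a₁ : ZMod (q : ℕ)) * (integralModelInt W).c₄ * r -
          (54 * ((integralModelInt W).b₆ : ZMod (q : ℕ)) -
            3 * ((integralModelInt W).b₂ : ZMod (q : ℕ)) * (integralModelInt W).b₄ +
            ((integralModelInt W).a₂ : ZMod (q : ℕ)) * (integralModelInt W).c₄) ≠ 0) →
      ¬ W.HasSplitMultiplicativeReductionAt v := by
    rintro q rfl hΔ' hc₄' h'
    exact W.not_hasSplitMultiplicativeReductionAt_of_forall_ne_zero v hΔ' hc₄' h'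
  exact key ⟨ℓ, hℓ⟩ hv' hΔ hc₄ h

/-- **`E(ℚ_ℓ)[p] = 0` and the clause (c3) at the place over a NON-SPLIT multiplicative prime `ℓ ≠ p` with
`p ∤ ℓ + 1`** (`p` odd; `ℓ ∣ Δ_min`, `ℓ ∤ c₄`; `q_v = ℓ`, tree `natCard_residueField_adicCompletionIntegers`).
[cite: DeoRaySujatha2023, Thm. 3.9, condition "E(F_v)[p] = 0 for every v ∈ S" (arXiv:2202.09937 p. 10)]
[cite: SilvermanAEC2009, Cor. C.15.2.1 (p0387) and Exercise 3.5 (p0097)] -/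
theorem geomPrimaryTorsion_eq_zero_of_decomp_fixed_of_nonsplit_rat {p ℓ : ℕ} (hp : p.Prime) (hp2 : p ≠ 2)
    (hℓ : ℓ.Prime) (hℓp : ℓ ≠ p) (v : HeightOneSpectrum (𝓞 ℚ)) (hv : (ℓ : 𝓞 ℚ) ∈ v.asIdeal)
    (hΔ : (ℓ : ℤ) ∣ minimalDiscriminantInt W) (hc₄ : ¬ (ℓ : ℤ) ∣ (integralModelInt W).c₄)
    (hns : ¬ W.HasSplitMultiplicativeReductionAt v) (hq : ¬ p ∣ ℓ + 1) :
    ∀ x : W.geomPrimaryTorsion p, p • x = 0 → (∀ d ∈ GreenbergSelmer.decomp v, d • x = x) → x = 0 := by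
  have hv' : primesEquiv v = ⟨ℓ, hℓ⟩ := by
    rw [(natCast_mem_asIdeal_iff_eq_primesEquiv_symm v hℓ).mp hv, Equiv.apply_symm_apply]
  have hℓv : (primesEquiv v : ℕ) = ℓ := congrArg Subtype.val hv'
  have hmult : W.HasMultiplicativeReductionAt v :=
    W.hasMultiplicativeReductionAt_of_dvd_of_not_dvd v (by rw [hℓv]; exact hΔ) (by rw [hℓv]; exact hc₄)
  have hpv : (p : 𝓞 ℚ) ∉ v.asIdeal := fun h ↦ hℓp <| by
    have h' := (natCast_mem_asIdeal_iff_eq_primesEquiv_symm v hp).mp h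
    rw [h', Equiv.apply_symm_apply] at hv'
    exact (congrArg Subtype.val hv').symm
  have hq' : ¬ p ∣ Nat.card (IsLocalRing.ResidueField (v.adicCompletionIntegers ℚ)) + 1 := by
    rw [natCard_residueField_adicCompletionIntegers v, hℓv]; exact hq
  exact W.geomPrimaryTorsion_eq_zero_of_decomp_fixed_of_nonsplit hmult hns hp hp2 hpv hq'

omit [W.IsElliptic] [W.IsGloballyMinimal] in
/-- **The clause (c3) at the place over `p` from `E(ℚ_p)[p] = 0` stated on Mathlib's `ℚ_[p]`** (transport of
points along `ℚ_v ≃ ℚ_p`, Mathlib `Padic.adicCompletionEquiv`, then Galois descent §1).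
[cite: DeoRaySujatha2023, Thm. 3.9, condition "E(F_v)[p] = 0 for every v ∈ S" (arXiv:2202.09937 p. 10)]
[cite: SilvermanAEC2009, I.§1 (p0016)] -/
theorem geomPrimaryTorsion_eq_zero_of_decomp_fixed_of_padic {p : ℕ} [Fact p.Prime]
    (v₀ : HeightOneSpectrum (𝓞 ℚ)) (hv₀ : (p : 𝓞 ℚ) ∈ v₀.asIdeal)
    (hQ : ∀ Q : (W.baseChange ℚ_[p]).toAffine.Point, p • Q = 0 → Q = 0) :
    ∀ x : W.geomPrimaryTorsion p, p • x = 0 → (∀ d ∈ GreenbergSelmer.decomp v₀, d • x = x) → x = 0 := by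
  obtain rfl := (natCast_mem_asIdeal_iff_eq_primesEquiv_symm v₀ (Fact.out : p.Prime)).mp hv₀
  set e : ((primesEquiv (R := 𝓞 ℚ)).symm ⟨p, Fact.out⟩).adicCompletion ℚ →+* ℚ_[p] :=
    (Padic.adicCompletionEquiv (R := 𝓞 ℚ) ⟨p, Fact.out⟩).symm.toAlgEquiv.toRingEquiv.toRingHom with he
  refine W.geomPrimaryTorsion_eq_zero_of_decomp_fixed_of_localPoints p _ (fun R hR ↦ ?_)
  have hmap := hQ (Affine.Point.map e.toRatAlgHom R) (by rw [← map_nsmul, hR, map_zero])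
  exact Affine.Point.map_injective (W' := W) e.toRatAlgHom (by rw [hmap, map_zero])

/-- **(c3) over `ℚ` from ONE divisibility `Δ_min ∣ p^a · c₄^b · m` and the clauses at the primes of `m` and
at `p`** (`p ≥ 5`, `W` globally minimal): a bad prime `ℓ ≠ p` divides `Δ_min` (Silverman VII.5.1 (a), tree
`hasGoodReductionAtPrime_of_not_dvd`), hence `c₄` — ADDITIVE reduction, where the clause is automatic
(`E(K_v^nr)[p^∞] = 0`) — or `m`, where the clause is supplied (`hm`); the place over `p` is unique.
[cite: DeoRaySujatha2023, Thm. 3.9, condition "E(F_v)[p] = 0 for every v ∈ S" (arXiv:2202.09937 p. 10)]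
[cite: SilvermanAEC2009, VII.5 Prop. 5.1 (p0174) and Thm. VII.6.1 (p0177)] -/
theorem geomPrimaryTorsion_decomp_fixed_eq_zero_of_dvd_pow_mul_pow_mul {p : ℕ} (hp : p.Prime) (hp5 : 5 ≤ p)
    {a b m : ℕ} (hrad : minimalDiscriminantInt W ∣ (p : ℤ) ^ a * (integralModelInt W).c₄ ^ b * (m : ℤ))
    (hm : ∀ v : HeightOneSpectrum (𝓞 ℚ), (primesEquiv v : ℕ) ∣ m → (primesEquiv v : ℕ) ≠ p →
      ¬ W.HasGoodReductionAt v →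
      ∀ x : W.geomPrimaryTorsion p, p • x = 0 → (∀ d ∈ GreenbergSelmer.decomp v, d • x = x) → x = 0)
    (v₀ : HeightOneSpectrum (𝓞 ℚ)) (hv₀ : (p : 𝓞 ℚ) ∈ v₀.asIdeal)
    (hlocp : ∀ x : W.geomPrimaryTorsion p, p • x = 0 → (∀ d ∈ GreenbergSelmer.decomp v₀, d • x = x) → x = 0) :
    ∀ v : HeightOneSpectrum (𝓞 ℚ), ((p : 𝓞 ℚ) ∈ v.asIdeal ∨ ¬ W.HasGoodReductionAt v) →
      ∀ x : W.geomPrimaryTorsion p, p • x = 0 → (∀ d ∈ GreenbergSelmer.decomp v, d • x = x) → x = 0 := by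
  refine W.geomPrimaryTorsion_decomp_fixed_eq_zero_of_additive_or_clause_away hp hp5 (fun v hbad hpv ↦ ?_)
    (forall_of_natCast_mem_asIdeal hp
      (C := fun v ↦ ∀ x : W.geomPrimaryTorsion p, p • x = 0 →
        (∀ d ∈ GreenbergSelmer.decomp v, d • x = x) → x = 0) v₀ hv₀ hlocp)
  haveI := Fact.mk (primesEquiv v).2
  have hℓ : ((primesEquiv v : Nat.Primes) : ℕ).Prime := (primesEquiv v).2
  -- `ℓ ∣ Δ_min`
  have hΔ : (((primesEquiv v : Nat.Primes) : ℕ) : ℤ) ∣ minimalDiscriminantInt W := by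
    by_contra hnd
    exact hbad ((hasGoodReductionAtPrime_iff_hasGoodReductionAt_ringOfIntegers v W).mp
      (hasGoodReductionAtPrime_of_not_dvd W _ hnd))
  have hℓZ : Prime ((((primesEquiv v : Nat.Primes) : ℕ) : ℤ)) := Nat.prime_iff_prime_int.mp hℓ
  -- `ℓ ≠ p`
  have hℓp : (primesEquiv v : ℕ) ≠ p := fun h ↦ hpv <| by
    have h2 : primesEquiv v = ⟨p, hp⟩ := Subtype.ext h
    exact (natCast_mem_asIdeal_iff_eq_primesEquiv_symm v hp).mpr ((Equiv.eq_symm_apply _).mpr h2)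
  by_cases hc₄ : (((primesEquiv v : Nat.Primes) : ℕ) : ℤ) ∣ (integralModelInt W).c₄
  · exact Or.inl (W.hasAdditiveReductionAt_of_dvd_of_dvd v hΔ hc₄)
  · refine Or.inr (hm v ?_ hℓp hbad)
    -- `ℓ ∣ p^a c₄^b m`, `ℓ ∤ p`, `ℓ ∤ c₄`, so `ℓ ∣ m`
    rcases hℓZ.dvd_or_dvd (hΔ.trans hrad) with h | h
    · rcases hℓZ.dvd_or_dvd h with h' | h'
      · exfalso
        have h1 : ((primesEquiv v : Nat.Primes) : ℕ) ∣ p := Int.natCast_dvd_natCast.mp (hℓZ.dvd_of_dvd_pow h')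
        exact hℓp ((Nat.prime_dvd_prime_iff_eq hℓ hp).mp h1)
      · exact absurd (hℓZ.dvd_of_dvd_pow h') hc₄
    · exact Int.natCast_dvd_natCast.mp h

/-- **(c3) over `ℚ`, no multiplicative prime needed (`m = 1`): `Δ_min ∣ p^a · c₄^b` and `E(ℚ_p)[p] = 0`**
(the tree's `geomPrimaryTorsion_decomp_fixed_eq_zero_of_dvd_pow_mul_pow` with the clause at `p` read on
`ℚ_[p]`).  [cite: DeoRaySujatha2023, Thm. 3.9, condition "E(F_v)[p] = 0 for every v ∈ S" (arXiv:2202.09937 p. 10)]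
[cite: SilvermanAEC2009, VII.5 Prop. 5.1 (p0174) and Thm. VII.6.1 (p0177)] -/
theorem geomPrimaryTorsion_decomp_fixed_eq_zero_of_dvd_pow_mul_pow_of_padic {p : ℕ} [Fact p.Prime]
    (hp5 : 5 ≤ p) {a b : ℕ} (hrad : minimalDiscriminantInt W ∣ (p : ℤ) ^ a * (integralModelInt W).c₄ ^ b)
    (hQ : ∀ Q : (W.baseChange ℚ_[p]).toAffine.Point, p • Q = 0 → Q = 0) :
    ∀ v : HeightOneSpectrum (𝓞 ℚ), ((p : 𝓞 ℚ) ∈ v.asIdeal ∨ ¬ W.HasGoodReductionAt v) →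
      ∀ x : W.geomPrimaryTorsion p, p • x = 0 → (∀ d ∈ GreenbergSelmer.decomp v, d • x = x) → x = 0 :=
  have hp : p.Prime := Fact.out
  W.geomPrimaryTorsion_decomp_fixed_eq_zero_of_dvd_pow_mul_pow hp hp5 hrad
    ((primesEquiv (R := 𝓞 ℚ)).symm ⟨p, hp⟩) ((natCast_mem_asIdeal_iff_eq_primesEquiv_symm _ hp).mpr rfl)
    (W.geomPrimaryTorsion_eq_zero_of_decomp_fixed_of_padic _
      ((natCast_mem_asIdeal_iff_eq_primesEquiv_symm _ hp).mpr rfl) hQ)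

/-- **(c3) over `ℚ` with ONE non-split multiplicative prime `ℓ`**: `Δ_min ∣ p^a · c₄^b · ℓ^c`, `ℓ ∤ c₄`,
`ℓ ≠ p`, `p ∤ ℓ + 1`, the reduction at `ℓ` is not split (certificates above), and `E(ℚ_p)[p] = 0`
(`p ≥ 5`, `W` globally minimal).
[cite: DeoRaySujatha2023, Thm. 3.9, condition "E(F_v)[p] = 0 for every v ∈ S" (arXiv:2202.09937 p. 10)]
[cite: SilvermanAEC2009, VII.5 Prop. 5.1 (p0174), Cor. C.15.2.1 (p0387)] -/
theorem geomPrimaryTorsion_decomp_fixed_eq_zero_of_nonsplit_of_padic {p : ℕ} [Fact p.Prime] (hp5 : 5 ≤ p)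
    {a b c ℓ : ℕ} (hℓ : ℓ.Prime) (hℓp : ℓ ≠ p)
    (hrad : minimalDiscriminantInt W ∣ (p : ℤ) ^ a * (integralModelInt W).c₄ ^ b * (ℓ : ℤ) ^ c)
    (hc₄ : ¬ (ℓ : ℤ) ∣ (integralModelInt W).c₄)
    (hns : ∀ v : HeightOneSpectrum (𝓞 ℚ), (ℓ : 𝓞 ℚ) ∈ v.asIdeal → ¬ W.HasSplitMultiplicativeReductionAt v)
    (hq : ¬ p ∣ ℓ + 1) (hQ : ∀ Q : (W.baseChange ℚ_[p]).toAffine.Point, p • Q = 0 → Q = 0) :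
    ∀ v : HeightOneSpectrum (𝓞 ℚ), ((p : 𝓞 ℚ) ∈ v.asIdeal ∨ ¬ W.HasGoodReductionAt v) →
      ∀ x : W.geomPrimaryTorsion p, p • x = 0 → (∀ d ∈ GreenbergSelmer.decomp v, d • x = x) → x = 0 := by
  have hp : p.Prime := Fact.out
  have hp2 : p ≠ 2 := by omega
  have hrad' : minimalDiscriminantInt W ∣ (p : ℤ) ^ a * (integralModelInt W).c₄ ^ b * ((ℓ ^ c : ℕ) : ℤ) := by
    rwa [Nat.cast_pow]
  refine W.geomPrimaryTorsion_decomp_fixed_eq_zero_of_dvd_pow_mul_pow_mul hp hp5 hrad' (fun v hv _ hbad ↦ ?_)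
    ((primesEquiv (R := 𝓞 ℚ)).symm ⟨p, hp⟩) ((natCast_mem_asIdeal_iff_eq_primesEquiv_symm _ hp).mpr rfl)
    (W.geomPrimaryTorsion_eq_zero_of_decomp_fixed_of_padic _
      ((natCast_mem_asIdeal_iff_eq_primesEquiv_symm _ hp).mpr rfl) hQ)
  -- `ℓ_v ∣ ℓ^c`, so `ℓ_v = ℓ` and `v` is the place over `ℓ`
  have hℓv : (primesEquiv v : ℕ) = ℓ :=
    (Nat.prime_dvd_prime_iff_eq (primesEquiv v).2 hℓ).mp ((primesEquiv v).2.dvd_of_dvd_pow hv)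
  have hvℓ : (ℓ : 𝓞 ℚ) ∈ v.asIdeal :=
    (natCast_mem_asIdeal_iff_eq_primesEquiv_symm v hℓ).mpr ((Equiv.eq_symm_apply _).mpr (Subtype.ext hℓv))
  have hΔ : (ℓ : ℤ) ∣ minimalDiscriminantInt W := by
    by_contra hnd
    haveI := Fact.mk (primesEquiv v).2
    have hnd' : ¬ (((primesEquiv v : Nat.Primes) : ℕ) : ℤ) ∣ minimalDiscriminantInt W := by rwa [hℓv]
    exact hbad ((hasGoodReductionAtPrime_iff_hasGoodReductionAt_ringOfIntegers v W).mp
      (hasGoodReductionAtPrime_of_not_dvd W _ hnd'))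
  exact W.geomPrimaryTorsion_eq_zero_of_decomp_fixed_of_nonsplit_rat hp hp2 hℓ hℓp v hvℓ hΔ hc₄ (hns v hvℓ) hq

/-- **(c3) over `ℚ` with TWO non-split multiplicative primes `ℓ₁, ℓ₂`**: `Δ_min ∣ p^a · c₄^b · ℓ₁^{c₁} · ℓ₂^{c₂}`,
and for `i = 1, 2`: `ℓᵢ ∤ c₄`, `ℓᵢ ≠ p`, `p ∤ ℓᵢ + 1`, non-split at `ℓᵢ`; and `E(ℚ_p)[p] = 0` (`p ≥ 5`).
[cite: DeoRaySujatha2023, Thm. 3.9, condition "E(F_v)[p] = 0 for every v ∈ S" (arXiv:2202.09937 p. 10)]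
[cite: SilvermanAEC2009, VII.5 Prop. 5.1 (p0174), Cor. C.15.2.1 (p0387)] -/
theorem geomPrimaryTorsion_decomp_fixed_eq_zero_of_nonsplit₂_of_padic {p : ℕ} [Fact p.Prime] (hp5 : 5 ≤ p)
    {a b c₁ ℓ₁ c₂ ℓ₂ : ℕ} (hℓ₁ : ℓ₁.Prime) (hℓ₁p : ℓ₁ ≠ p) (hℓ₂ : ℓ₂.Prime) (hℓ₂p : ℓ₂ ≠ p)
    (hrad : minimalDiscriminantInt W ∣
      (p : ℤ) ^ a * (integralModelInt W).c₄ ^ b * ((ℓ₁ : ℤ) ^ c₁ * (ℓ₂ : ℤ) ^ c₂))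
    (hc₄₁ : ¬ (ℓ₁ : ℤ) ∣ (integralModelInt W).c₄)
    (hns₁ : ∀ v : HeightOneSpectrum (𝓞 ℚ), (ℓ₁ : 𝓞 ℚ) ∈ v.asIdeal → ¬ W.HasSplitMultiplicativeReductionAt v)
    (hq₁ : ¬ p ∣ ℓ₁ + 1)
    (hc₄₂ : ¬ (ℓ₂ : ℤ) ∣ (integralModelInt W).c₄)
    (hns₂ : ∀ v : HeightOneSpectrum (𝓞 ℚ), (ℓ₂ : 𝓞 ℚ) ∈ v.asIdeal → ¬ W.HasSplitMultiplicativeReductionAt v)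
    (hq₂ : ¬ p ∣ ℓ₂ + 1) (hQ : ∀ Q : (W.baseChange ℚ_[p]).toAffine.Point, p • Q = 0 → Q = 0) :
    ∀ v : HeightOneSpectrum (𝓞 ℚ), ((p : 𝓞 ℚ) ∈ v.asIdeal ∨ ¬ W.HasGoodReductionAt v) →
      ∀ x : W.geomPrimaryTorsion p, p • x = 0 → (∀ d ∈ GreenbergSelmer.decomp v, d • x = x) → x = 0 := by
  have hp : p.Prime := Fact.out
  have hp2 : p ≠ 2 := by omega
  have hrad' : minimalDiscriminantInt W ∣
      (p : ℤ) ^ a * (integralModelInt W).c₄ ^ b * ((ℓ₁ ^ c₁ * ℓ₂ ^ c₂ : ℕ) : ℤ) := by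
    rwa [Nat.cast_mul, Nat.cast_pow, Nat.cast_pow]
  refine W.geomPrimaryTorsion_decomp_fixed_eq_zero_of_dvd_pow_mul_pow_mul hp hp5 hrad' (fun v hv _ hbad ↦ ?_)
    ((primesEquiv (R := 𝓞 ℚ)).symm ⟨p, hp⟩) ((natCast_mem_asIdeal_iff_eq_primesEquiv_symm _ hp).mpr rfl)
    (W.geomPrimaryTorsion_eq_zero_of_decomp_fixed_of_padic _
      ((natCast_mem_asIdeal_iff_eq_primesEquiv_symm _ hp).mpr rfl) hQ)
  haveI := Fact.mk (primesEquiv v).2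
  -- the clause at `v` over `ℓ ∈ {ℓ₁, ℓ₂}` from the data at `ℓ`
  have clause : ∀ ℓ : ℕ, ℓ.Prime → ℓ ≠ p → (primesEquiv v : ℕ) = ℓ → ¬ (ℓ : ℤ) ∣ (integralModelInt W).c₄ →
      (∀ w : HeightOneSpectrum (𝓞 ℚ), (ℓ : 𝓞 ℚ) ∈ w.asIdeal → ¬ W.HasSplitMultiplicativeReductionAt w) →
      ¬ p ∣ ℓ + 1 →
      ∀ x : W.geomPrimaryTorsion p, p • x = 0 → (∀ d ∈ GreenbergSelmer.decomp v, d • x = x) → x = 0 := by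
    intro ℓ hℓ hℓp hℓv hc₄ hns hq
    have hvℓ : (ℓ : 𝓞 ℚ) ∈ v.asIdeal :=
      (natCast_mem_asIdeal_iff_eq_primesEquiv_symm v hℓ).mpr ((Equiv.eq_symm_apply _).mpr (Subtype.ext hℓv))
    have hΔ : (ℓ : ℤ) ∣ minimalDiscriminantInt W := by
      by_contra hnd
      have hnd' : ¬ (((primesEquiv v : Nat.Primes) : ℕ) : ℤ) ∣ minimalDiscriminantInt W := by rwa [hℓv]
      exact hbad ((hasGoodReductionAtPrime_iff_hasGoodReductionAt_ringOfIntegers v W).mp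
        (hasGoodReductionAtPrime_of_not_dvd W _ hnd'))
    exact W.geomPrimaryTorsion_eq_zero_of_decomp_fixed_of_nonsplit_rat hp hp2 hℓ hℓp v hvℓ hΔ hc₄ (hns v hvℓ) hq
  -- `ℓ_v ∣ ℓ₁^{c₁} ℓ₂^{c₂}`
  rcases (Nat.Prime.dvd_mul (primesEquiv v).2).mp hv with h | h
  · exact clause ℓ₁ hℓ₁ hℓ₁p
      ((Nat.prime_dvd_prime_iff_eq (primesEquiv v).2 hℓ₁).mp ((primesEquiv v).2.dvd_of_dvd_pow h)) hc₄₁ hns₁ hq₁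
  · exact clause ℓ₂ hℓ₂ hℓ₂p
      ((Nat.prime_dvd_prime_iff_eq (primesEquiv v).2 hℓ₂).mp ((primesEquiv v).2.dvd_of_dvd_pow h)) hc₄₂ hns₂ hq₂

end Rat

end WeierstrassCurve

end
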